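import Literature.AlgebraicGeometry.Motives.AbelianVarietyIsogenyPullbackPushforwardHolds
import HarnessLib

/-!
# `g^*(g_*F) ⟶ ∏_{x ∈ Ker g(ℂ)} t_x^*F` IS an isomorphism for every isogeny — the canonical (natural) form of the decomposition

Layer `Literature/AlgebraicGeometry/Motives`, namespace `Literature.AlgebraicGeometry.Motives.AbelianVariety`.
(Typing debt of cell `pub-hodge-ring2`, director-hodge g14 R14.24 ∕ R14.26 (2), seat core-D, «(L4♮)∕(D♮) the NATURAL form of
`IsogenyPullbackPushforwardDecomposition` typed against `Literature.AlgebraicGeometry.Modules.toPi`»; in support of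
`stmt-HodgeConjecture-26512`; research route conditional on HC_CM; not a corollary; Q11.4-sentence-2 already refuted in dim ≥ 3.)

The named fact `IsogenyPullbackPushforwardDecomposition` (p627672, PROVED as `isogenyPullbackPushforwardDecomposition_holds`,
`AbelianVarietyIsogenyPullbackPushforwardHolds.lean`) only records `Nonempty (g^*g_*F ≅ ∐_x t_x^*F)` for vector bundles `F`. Its proof
in fact shows more, and this file extracts it BY NAME:

* `exists_chartInvariants_torsionQuotHom`, `exists_chartInvariants_kerTranslation` — **(Inv) for EVERY complex isogeny** `g : A → B`:
  every point of `B` has an affine neighbourhood `V` with `Γ(B, V) ↠ Γ(A, g⁻¹V)^{Ker g(ℂ)}` (`ChartInvariants` for the kernel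
  translations; Mumford §7 Theorem p. 66 (2) with Thm. 4 p. 72: `B = A/Ker g` and `Γ(U, 𝒪_{X/G}) = Γ(π⁻¹U, 𝒪_X)^G`) — first for the
  tree's quotient maps `π : A → A/S` (`exists_quotientMap_appLE_eq`), then transported along `A/Ker g ≅ B`
  (`IsIsogeny.exists_torsionQuot_iso_comp_eq`, `exists_chartInvariants_comp_iso`).
* **`isIso_toPi_kerTranslation`** — for every isogeny `g : A → B` of complex abelian varieties and every AFFINE-LOCALIZING
  `𝒪_A`-module `F` (in particular every quasi-coherent module, every vector bundle: `isIso_toPi_kerTranslation_of_isQuasicoherent`,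
  `isIso_toPi_kerTranslation_of_isFiniteLocallyFree`), the CANONICAL comparison map
  `toPi (Hom.toSchemeHom g) (kerTranslation g) _ F : g^*g_*F ⟶ ∏_{x ∈ Ker g(ℂ)} t_x^*F` (the tuple of
  `g^*g_*F = (t_x ≫ g)^*g_*F ≅ t_x^*g^*g_*F → t_x^*F`, `Literature/AlgebraicGeometry/Modules/PullbackPushforwardTwist.lean`) IS AN
  ISOMORPHISM (`isIso_toPi_of_galoisCharts`: module Chase–Harrison–Rosenberg on the affine charts, Greither LNM 1534 Ch. 0 Thm. 1.6,
  with `chartFree_kerTranslation` and (Inv)). This is Mumford's `π^*π_*F ≅ ⊕_{x ∈ K} T_x^*F` (§7 Thm. 4, §12 Thm. 1) as a statement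
  about a NAMED, NATURAL map (naturality in `F`: `Literature.AlgebraicGeometry.Modules.toPi_naturality`,
  `PullbackPushforwardTwistNaturality.lean`), which is what the complex-level ∕ derived consumers need; the `Nonempty` fact is
  recovered as `nonempty_pullback_pushforward_iso_sigma_of_isAffineLocalizing`.

## References

* [MumfordAV1970] D. Mumford, *Abelian Varieties* (1970), §7 Theorem p. 66 (2) and Thm. 4 (p. 72); §12 Thm. 1 (p. 111).
* [Greither1992CyclicGalois] C. Greither, LNM 1534 (1992), Ch. 0 Thm. 1.6, Lemma 1.10.
* [Hartshorne1977] R. Hartshorne, GTM 52, II.5 p. 110 and Lemma 5.3.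
-/

noncomputable section

universe u

open CategoryTheory CategoryTheory.Limits AlgebraicGeometry TopologicalSpace

namespace Literature.AlgebraicGeometry.Motives

namespace AbelianVariety

open Literature.AlgebraicGeometry.Modules

/-! ## §1 (Inv): the `Ker g`-invariant functions on `g⁻¹V` come from `V`, for every complex isogeny -/

/-- **(Inv) for the quotient maps `π : A → A/S`** of the tree (`AbelianVariety.torsionQuotHom`, `S ⊆ A[n](ℂ)`, the subgroup acting
by the translations `t_s`): every point of `A/S` has an affine neighbourhood `V` such that every `S`-invariant function on `π⁻¹V`
comes from `V` — `A/S = Spec_A` of the invariants, chart by chart (`exists_quotientMap_appLE_eq`; the body of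
`isogenyPullbackPushforwardDecomposition_holds`). [cite: MumfordAV1970, §7 Theorem p. 66 (2) and Thm. 4 (p. 72)] -/
theorem exists_chartInvariants_torsionQuotHom (A : AbelianVariety ℂ) {n : ℕ} (hn : n ≠ 0) (S : Subgroup (A.Points ℂ))
    (hS : S ≤ A.torsionPoints ℂ n) (y : (A.torsionQuot hn S hS).X.left) :
    ∃ V : (A.torsionQuot hn S hS).X.left.Opens, y ∈ V ∧ IsAffineOpen V ∧
      ChartInvariants (Hom.toSchemeHom (A.torsionQuotHom hn S hS)) (subgroupTranslation A S)
        (subgroupTranslation_comp_torsionQuotHom A hn S hS) V := by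
  haveI := A.isAffineHom_toSchemeHom_zsmul_id hn
  haveI : Finite S := A.finite_of_le_torsionPoints hn hS
  have hSq : ∀ s ∈ S, s ≫ (((n : ℤ) • 𝟙 A :) ).hom.hom.hom = 1 := A.comp_zsmul_id_eq_one_of_le_torsionPoints hS
  -- the quotient datum `A/S = Y/G`, `Y = A_ℂ`, `G = S ⋊ Aut(ℂ/ℂ)`, `r = pr ≫ [n]`
  let ρ := A.quotAction ℂ S (A.smul_mem_of_algEquiv_self S) ((n : ℤ) • 𝟙 A) hSq
  -- an affine chart `U ∋ (A/S → A)(y)` of `A` and the affine chart `(A/S → A)⁻¹U ∋ y` of `A/S`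
  obtain ⟨U, hU, hyU, -⟩ := Opens.isBasis_iff_nbhd.mp A.X.left.isBasis_affineOpens
    (show ρ.quotientToBase.base y ∈ (⊤ : A.X.left.Opens) from trivial)
  refine ⟨ρ.quotientToBase ⁻¹ᵁ U, hyU, hU.preimage ρ.quotientToBase, ?_⟩
  -- the invariant functions on `[n]⁻¹U = π⁻¹((A/S → A)⁻¹U)` descend (`exists_quotientMap_appLE_eq`)
  exact chartInvariants_of_sections _ _ _
    (A.quotientMap_preimage_quotientToBase_preimage S (A.smul_mem_of_algEquiv_self S) ((n : ℤ) • 𝟙 A) hSq U)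
    (fun s => A.preimage_le_translation_preimage S ((n : ℤ) • 𝟙 A) hSq U s) fun c hc =>
      A.exists_quotientMap_appLE_eq S (A.smul_mem_of_algEquiv_self S) ((n : ℤ) • 𝟙 A) hSq ⟨U, hU⟩ c hc

variable {A B : AbelianVariety ℂ} (g : A ⟶ B)

/-- **(Inv) for every complex isogeny**: for an isogeny `g : A → B` of complex abelian varieties, every point of `B` has an affine
neighbourhood `V` such that every `Ker g(ℂ)`-invariant function on `g⁻¹V` comes from `V` (`ChartInvariants` for the kernel
translations `t_x`): `g = π ≫ e` with `π : A → A/Ker g` the tree's quotient map and `e : A/Ker g ≅ B`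
(`IsIsogeny.exists_torsionQuot_iso_comp_eq`), (Inv) for `π` (`exists_chartInvariants_torsionQuotHom`) transported along `e`
(`exists_chartInvariants_comp_iso`). [cite: MumfordAV1970, §7 Theorem p. 66 (2) and Thm. 4 (p. 72)] -/
theorem exists_chartInvariants_kerTranslation (hg : IsIsogeny g) (y : B.X.left) :
    ∃ V : B.X.left.Opens, y ∈ V ∧ IsAffineOpen V ∧
      ChartInvariants (Hom.toSchemeHom g) (kerTranslation g) (kerTranslation_comp g) V := by
  obtain ⟨e, he⟩ := hg.exists_torsionQuot_iso_comp_eq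
  have hgg' : Hom.toSchemeHom (A.torsionQuotHom hg.kerRank_ne_zero _ hg.kerPoints_le_torsionPoints_kerRank) ≫
      (schemeIsoOfIso e).hom = Hom.toSchemeHom g :=
    congrArg Hom.toSchemeHom he
  have hτ' : ∀ x : Hom.kerPoints (specOver ℂ ℂ) g, kerTranslation g x ≫
      (Hom.toSchemeHom (A.torsionQuotHom hg.kerRank_ne_zero _ hg.kerPoints_le_torsionPoints_kerRank) ≫
        (schemeIsoOfIso e).hom) =
      Hom.toSchemeHom (A.torsionQuotHom hg.kerRank_ne_zero _ hg.kerPoints_le_torsionPoints_kerRank) ≫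
        (schemeIsoOfIso e).hom := fun x => by
    rw [← Category.assoc, subgroupTranslation_comp_torsionQuotHom]
  obtain ⟨V, hyV, hV, hinv⟩ := exists_chartInvariants_comp_iso _ (schemeIsoOfIso e) (kerTranslation g)
    (subgroupTranslation_comp_torsionQuotHom A hg.kerRank_ne_zero _ hg.kerPoints_le_torsionPoints_kerRank) hτ'
    (exists_chartInvariants_torsionQuotHom A hg.kerRank_ne_zero _ hg.kerPoints_le_torsionPoints_kerRank) y
  exact ⟨V, hyV, hV, (chartInvariants_congr hgg' (kerTranslation g) hτ' (kerTranslation_comp g) V).1 hinv⟩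

/-- **Galois charts for every complex isogeny**: every point of `B` has an affine neighbourhood `V` over which the kernel
translations act freely on `g⁻¹V` (`ChartFree`, `chartFree_kerTranslation`) and the invariant functions descend (`ChartInvariants`).
[cite: MumfordAV1970, §7 Thm. 4 (p. 72)] [cite: Greither1992CyclicGalois, Ch. 0 Thm. 1.6 (pp. 3–4)] -/
theorem exists_galoisChart_kerTranslation (hg : IsIsogeny g) (y : B.X.left) :
    ∃ V : B.X.left.Opens, y ∈ V ∧ IsAffineOpen V ∧
      ChartFree (Hom.toSchemeHom g) (kerTranslation g) (kerTranslation_comp g) V ∧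
        ChartInvariants (Hom.toSchemeHom g) (kerTranslation g) (kerTranslation_comp g) V := by
  obtain ⟨V, hyV, hV, hinv⟩ := exists_chartInvariants_kerTranslation g hg y
  exact ⟨V, hyV, hV, chartFree_kerTranslation g hg hV, hinv⟩

/-! ## §2 The canonical comparison `toPi : g^*g_*F ⟶ ∏_x t_x^*F` is an isomorphism -/

/-- **`toPi : g^*(g_*F) ⟶ ∏_{x ∈ Ker g(ℂ)} t_x^*F` is an isomorphism** for every isogeny `g : A → B` of complex abelian varieties and
every affine-localizing `𝒪_A`-module `F` — the canonical, natural form of Mumford's `π^*π_*F ≅ ⊕_{x ∈ K} T_x^*F` (§7 Thm. 4, §12 Thm. 1):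
`isIso_toPi_of_galoisCharts` (module Chase–Harrison–Rosenberg on the charts) with `exists_galoisChart_kerTranslation`.
[cite: MumfordAV1970, §7 Thm. 4 (p. 72) and §12 Thm. 1 (p. 111)] [cite: Greither1992CyclicGalois, Ch. 0 Thm. 1.6, Lemma 1.10] -/
theorem isIso_toPi_kerTranslation (hg : IsIsogeny g) (F : A.X.left.Modules) (hF : IsAffineLocalizing F) :
    IsIso (toPi (Hom.toSchemeHom g) (kerTranslation g) (kerTranslation_comp g) F) := by
  haveI := hg.2
  haveI : Finite (Hom.kerPoints (specOver ℂ ℂ) g) := finite_kerPoints_of_isFinite g ℂ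
  letI : Fintype (Hom.kerPoints (specOver ℂ ℂ) g) := Fintype.ofFinite _
  exact isIso_toPi_of_galoisCharts (Hom.toSchemeHom g) (kerTranslation g) (kerTranslation_comp g)
    (subgroupTranslation_one A _) (subgroupTranslation_mul A _) F hF (exists_galoisChart_kerTranslation g hg)

/-- **`toPi : g^*(g_*F) ⟶ ∏_x t_x^*F` is an isomorphism for quasi-coherent `F`** (quasi-coherent modules are affine-localizing,
Hartshorne II Lemma 5.3). [cite: MumfordAV1970, §7 Thm. 4 (p. 72) and §12 Thm. 1 (p. 111)] [cite: Hartshorne1977, II Lemma 5.3 (p. 112)] -/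
theorem isIso_toPi_kerTranslation_of_isQuasicoherent (hg : IsIsogeny g) (F : A.X.left.Modules) [F.IsQuasicoherent] :
    IsIso (toPi (Hom.toSchemeHom g) (kerTranslation g) (kerTranslation_comp g) F) :=
  isIso_toPi_kerTranslation g hg F (IsAffineLocalizing.of_isQuasicoherent F)

/-- **`toPi : g^*(g_*F) ⟶ ∏_x t_x^*F` is an isomorphism for a vector bundle `F`** (finite locally free ⇒ quasi-coherent).
[cite: MumfordAV1970, §7 Thm. 4 (p. 72) and §12 Thm. 1 (p. 111)] -/
theorem isIso_toPi_kerTranslation_of_isFiniteLocallyFree (hg : IsIsogeny g) (F : A.X.left.Modules)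
    (hF : IsFiniteLocallyFree F) :
    IsIso (toPi (Hom.toSchemeHom g) (kerTranslation g) (kerTranslation_comp g) F) := by
  haveI := hF.isVectorBundle.1
  exact isIso_toPi_kerTranslation_of_isQuasicoherent g hg F

/-- **`g^*(g_*F) ≅ ∐_{x ∈ Ker g(ℂ)} t_x^*F` for every affine-localizing `F`** (in particular quasi-coherent `F`; the named fact
`IsogenyPullbackPushforwardDecomposition` is the vector-bundle case): from `isIso_toPi_kerTranslation`, finite products of
`𝒪_A`-modules being biproducts. [cite: MumfordAV1970, §7 Thm. 4 (p. 72) and §12 Thm. 1 (p. 111)] -/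
theorem nonempty_pullback_pushforward_iso_sigma_of_isAffineLocalizing (hg : IsIsogeny g) (F : A.X.left.Modules)
    (hF : IsAffineLocalizing F) :
    Nonempty ((Scheme.Modules.pullback (Hom.toSchemeHom g)).obj
        ((Scheme.Modules.pushforward (Hom.toSchemeHom g)).obj F) ≅
      ∐ fun x : Hom.kerPoints (specOver ℂ ℂ) g => (Scheme.Modules.pullback (A.translation x.1).left).obj F) := by
  haveI := hg.2
  haveI : Finite (Hom.kerPoints (specOver ℂ ℂ) g) := finite_kerPoints_of_isFinite g ℂ
  exact nonempty_iso_sigmaObj_of_isIso_toPi (Hom.toSchemeHom g) (kerTranslation g) (kerTranslation_comp g) F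
    (isIso_toPi_kerTranslation g hg F hF)

end AbelianVariety

end Literature.AlgebraicGeometry.Motives

end
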